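import Summits.Ventures.QEC.Census.BB.BB288.CoverL21K0
import Summits.Ventures.QEC.Census.BB.BB288.CoverL21K1
import Summits.Ventures.QEC.Census.BB.BB288.CoverL21K2
import Summits.Ventures.QEC.Census.BB.BB288.CoverL21K3
import Summits.Ventures.QEC.Census.BB.BB288.CoverL21K4
import Summits.Ventures.QEC.Census.BB.BB288.CoverL21K5
import Summits.Ventures.QEC.Census.BB.BB288.CoverL21K6
import Summits.Ventures.QEC.Census.BB.BB288.CoverL21Q0
import HarnessLib

set_option Elab.async false

/-!
# `[[288,12,18]]` cover certificate — LEVEL 2→1 COLLECTOR: `hprob2` — every one of the 273 listed level-2 representatives has its candidate list (exactly the `hprob2` hypothesis of T2 `cov_of_levels`, with `cand2` of CoverL21Q); `hprob2_of` is the same modulo the `s = 0` verdict, `hprob2` plugs `CoverL21Q0.q0_ok`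
(qec-search-9 g4 LINK module per qec-type-10 COVER-ASSEMBLY-TEMPLATE v1.0 §1/§2; generated by work/links/gen_links.py.)
-/

namespace Summit.Ventures.QEC.Census.BB288Cover

open Summit.Ventures.QEC.Census

/-- **hprob2** modulo the `s = 0` verdict: all level-2→1 representatives produce listed candidates. -/
theorem hprob2_of (h0 : cosetOK 72 Hq2 D2 q0 = true) : ∀ j : ℕ, j < reps2.length → ∀ u : ℕ, u < 2 ^ cov1.nq → synZero cov1.nq bb144HX u = true →
    (∀ l ∈ Lam2, popc cov1.nq (l &&& u) % 2 = 0) → cov2.push u = reps2.getD j 0 → popc cov1.nq u ≤ 16 → u ∈ cand2 j := by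
  intro j hj
  rw [reps2_length] at hj
  show ∀ u : ℕ, u < 2 ^ 144 → synZero 144 bb144HX u = true → (∀ l ∈ Lam2, popc 144 (l &&& u) % 2 = 0) → cov2.push u = reps2.getD j 0 → popc 144 u ≤ 16 → u ∈ listGen cov2 (qlist.getD j q0) (reps2.getD j 0)
  rcases Nat.lt_or_ge j 40 with c0 | c0
  · exact cands_ok_0 h0 j c0 (Nat.zero_le j)
  rcases Nat.lt_or_ge j 80 with c1 | c1
  · exact cands_ok_1 j c1 c0
  rcases Nat.lt_or_ge j 120 with c2 | c2
  · exact cands_ok_2 j c2 c1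
  rcases Nat.lt_or_ge j 160 with c3 | c3
  · exact cands_ok_3 j c3 c2
  rcases Nat.lt_or_ge j 200 with c4 | c4
  · exact cands_ok_4 j c4 c3
  rcases Nat.lt_or_ge j 240 with c5 | c5
  · exact cands_ok_5 j c5 c4
  exact cands_ok_6 j hj c5

/-- **hprob2** (T2 `cov_of_levels`): unconditional, with problem 0 closed by `CoverL21Q0.q0_ok`. -/
theorem hprob2 : ∀ j : ℕ, j < reps2.length → ∀ u : ℕ, u < 2 ^ cov1.nq → synZero cov1.nq bb144HX u = true →
    (∀ l ∈ Lam2, popc cov1.nq (l &&& u) % 2 = 0) → cov2.push u = reps2.getD j 0 → popc cov1.nq u ≤ 16 → u ∈ cand2 j :=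
  hprob2_of q0_ok

end Summit.Ventures.QEC.Census.BB288Cover
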